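import Summits.Ventures.LatticeQCDFlow.Scaling.TaggedCostSideDeep

/-!
HONEST FRAMING: exact (Metropolis-corrected) sampling algorithms for lattice gauge theory; figures
of merit are autocorrelation/cost numbers at stated couplings and volumes; no continuum-physics
claim.

# TaggedCostSideDeepTwo — THE COST-SIDE INEQUALITY OF ROUTE (β) IN THE DEEP CONFIGURATION AT `K = 2` (THE SECOND STEP'S INCOME), HENCE FOR EVERY `K ≥ 2`:
# `L·Σ_{n<J}(1−σ)σⁿ(y_{n+1}(z) − x_{n+1}(z))⁺ ≤ 2·s1`, `s1 = (K+M_X)x̃(★) − cost(x̃)`, `L = 2K + M_X + M_Y` (lean-2 GEN-42, ours)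

Venture-side (OURS).  Cell `lqcd-flow` (pub-lqcd), unit `pub-lqcd-lean-2-g42`, 2026-08-30.  Chapter AB (route (β), the cost side continued), file 1.  GEN-41's file 7
(`tagged_costSide_deep`) paid the discounted start-content deficit of a depth-adjacent pair in the deep configuration (`W_z ≤ W_b ≤ W_a`, `W_z < W_a`, three particles at or
above `z`) out of the FIRST step's ★-certificate slack, which suffices for `K ≥ 3` only (margin `1/27` at `K = 3`; at `K = 2` the first step alone fails, MEMO-gen41 §3).  Here the
SECOND step's income is added: by GEN-41 file 4 (`ledger_tail_eq`) `s1 = (1−σ)slack(z) + σE_x̃[slack] + (1−σ)(1−θ_a)x̃(★)` exactly, and `E_x̃[slack] ≥ (1−σ)Σ_v P_X(z,v)slack(v)`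
over the PRESENT contents `v` (`x̃ ≥ (1−σ)P_X(z,·)` pointwise, `slack ≥ 0` at present contents, `x̃` gives no mass to absent ones — W15).  At `K = 2` the deep configuration has
either both ordinary particles at `z`, or one at `z` and one at a content `w` strictly more persistent than `z`; in both cases EVERY present content `v` has holding probability
`P_X(v,v) ≤ N_C(v)/K` (at `z` because a deficit needs it, at `w` because the swap with the deeper `z` is always accepted), so file 7's hub-slack bound applies at every present content:
`slack(v) ≥ acc(v,a)·3θ_a/2 ≥ acc(z,a)·3θ_a/2 =: c`.  Hence `s1 ≥ (1−σ)c(1 + σ(1 − acc(z,a)/2))`, against the budget `L(1−σ)γσq/(1−σ²q²)` of GEN-41 file 6 (A)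
(`γ ≤ (1−α)/2`, `q ≤ α/2`, `α = acc(z,a)`, `L ≤ 10`): the scalar inequality `10(1−α)σα/(4−α²) ≤ (3/2)ασ(2 − α/2)` is `0 ≤ 2 + 7α − 3α² + (3/4)α³`.

* §1 `costSide_scalar_two` (the scalar inequality at `K = 2`); §2 `costSide_two_particles` (the compositions of two particles), `costSide_hold_of_deeper` (a content with a
  deeper present particle at `K = 2` holds with probability `≤ N_C/K`), `costSide_acc_mono` (`acc(z,a) ≤ acc(v,a)` for `W_z ≤ W_v`), `costSide_secondStep_ge`
  (`E_x̃[slack] ≥ (1−σ)·c·(1 − P_X(z,★))` when `slack ≥ c` at every present content); §3 **`tagged_costSide_deep_two`** (`K = 2`) and **`tagged_costSide_deep_all`** (every `K ≥ 2`,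
  with file 7).

Hypotheses verbatim as in file 7.  Exact ties, the residual pair and global edges are not covered (memo MEMO-gen42).  Literature grade (cell rule): OWN; nothing cited; no new bib keys.
-/

open Finset

namespace Summit.Ventures.LatticeQCDFlow.Scaling

/-! ### §1 The scalar inequality at `K = 2` -/
section CostScalarTwo

/-- **`L·γ·σq/(1−(σq)²) ≤ 2·(α·3θ_a/2)·(1 + σ(1 − α/2))`** for `L ≤ 10`, `0 ≤ γ ≤ (1−α)/2`, `0 ≤ q ≤ α/2`, `σ ∈ [0,1]`, `α ∈ [0,1]`, `θ_a ∈ [½,1]`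
(the two-step income at `K = 2`; reduces to `0 ≤ 2 + 7α − 3α² + (3/4)α³`). [ours] -/
theorem costSide_scalar_two {L α θa q γ σ : ℝ} (hL : L ≤ 10) (hα0 : 0 ≤ α) (hα1 : α ≤ 1)
    (hθ : 1 / 2 ≤ θa) (hγ0 : 0 ≤ γ) (hγ : γ ≤ (1 - α) / 2) (hq0 : 0 ≤ q) (hq : q ≤ α / 2) (hσ0 : 0 ≤ σ) (hσ1 : σ ≤ 1) :
    L * (γ * (σ * q / (1 - (σ * q) ^ 2))) ≤ 2 * (α * (3 * θa) / 2 * (1 + σ * (1 - α / 2))) := by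
  have hσq0 : 0 ≤ σ * q := mul_nonneg hσ0 hq0
  have hσqle : σ * q ≤ σ * (α / 2) := mul_le_mul_of_nonneg_left hq hσ0
  have hσq : σ * q ≤ α / 2 := by nlinarith
  have hα2 : α / 2 ≤ 1 / 2 := by linarith
  -- `σq/(1−(σq)²) ≤ (σα/2)/(1−(α/2)²)`
  have hden1 : 0 < 1 - (σ * q) ^ 2 := by nlinarith
  have hden2 : 0 < 1 - (α / 2) ^ 2 := by nlinarith
  have hfrac : σ * q / (1 - (σ * q) ^ 2) ≤ σ * (α / 2) / (1 - (α / 2) ^ 2) := by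
    rw [div_le_div_iff₀ hden1 hden2]
    have h1 : σ * q * (1 - (α / 2) ^ 2) ≤ σ * (α / 2) * (1 - (α / 2) ^ 2) := mul_le_mul_of_nonneg_right hσqle hden2.le
    have h2 : σ * (α / 2) * (1 - (α / 2) ^ 2) ≤ σ * (α / 2) * (1 - (σ * q) ^ 2) := by
      apply mul_le_mul_of_nonneg_left _ (mul_nonneg hσ0 (by linarith))
      nlinarith [mul_nonneg hσq0 hσq0]
    linarith
  have hfrac0 : 0 ≤ σ * q / (1 - (σ * q) ^ 2) := div_nonneg hσq0 hden1.le
  -- the left side is at most `10·((1−α)/2)·((σα/2)/(1−(α/2)²))`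
  have hL0' : L * (γ * (σ * q / (1 - (σ * q) ^ 2))) ≤ 10 * (((1 - α) / 2) * (σ * (α / 2) / (1 - (α / 2) ^ 2))) := by
    have hx : γ * (σ * q / (1 - (σ * q) ^ 2)) ≤ ((1 - α) / 2) * (σ * (α / 2) / (1 - (α / 2) ^ 2)) :=
      mul_le_mul hγ hfrac hfrac0 (by linarith)
    have hx0 : 0 ≤ γ * (σ * q / (1 - (σ * q) ^ 2)) := mul_nonneg hγ0 hfrac0
    by_cases hLn : 0 ≤ L
    · exact (mul_le_mul_of_nonneg_left hx hLn).trans (mul_le_mul_of_nonneg_right hL (le_trans hx0 hx))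
    · have : L * (γ * (σ * q / (1 - (σ * q) ^ 2))) ≤ 0 := mul_nonpos_of_nonpos_of_nonneg (le_of_lt (not_le.mp hLn)) hx0
      exact this.trans (mul_nonneg (by norm_num) (le_trans hx0 hx))
  refine hL0'.trans ?_
  -- clear the denominator `1 − (α/2)² = (4 − α²)/4`
  have e1 : 10 * (((1 - α) / 2) * (σ * (α / 2) / (1 - (α / 2) ^ 2))) = 10 * (1 - α) * σ * α / (4 - α ^ 2) := by
    field_simp
    ring
  have hKα : 0 < 4 - α ^ 2 := by nlinarith
  rw [e1, div_le_iff₀ hKα]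
  -- `10(1−α)σα ≤ 3αθ_a(1 + σ(1−α/2))(4−α²)`, from `θ_a ≥ ½`, `1 ≥ σ` and `0 ≤ 2 + 7α − 3α² + (3/4)α³`
  have hpoly : 0 ≤ 2 + 7 * α - 3 * α ^ 2 + 3 / 4 * α ^ 3 := by
    have hsq : α ^ 2 ≤ α := by nlinarith
    have hcu : 0 ≤ α ^ 3 := pow_nonneg hα0 3
    linarith
  have hσα : 0 ≤ σ * α := mul_nonneg hσ0 hα0
  -- `(1 + σ(1−α/2)) ≥ σ(2 − α/2)`
  have hstep : σ * (2 - α / 2) ≤ 1 + σ * (1 - α / 2) := by linarith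
  have h2 : 0 ≤ 2 - α / 2 := by linarith
  -- right side `≥ (3/2)·α·σ(2−α/2)(4−α²)`
  have hR : 3 / 2 * α * (σ * (2 - α / 2)) * (4 - α ^ 2) ≤ 2 * (α * (3 * θa) / 2 * (1 + σ * (1 - α / 2))) * (4 - α ^ 2) := by
    have hθ' : 3 / 2 * α ≤ α * (3 * θa) := by nlinarith
    have hA : 0 ≤ 1 + σ * (1 - α / 2) := by nlinarith
    calc 3 / 2 * α * (σ * (2 - α / 2)) * (4 - α ^ 2) ≤ 3 / 2 * α * (1 + σ * (1 - α / 2)) * (4 - α ^ 2) := by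
          apply mul_le_mul_of_nonneg_right _ hKα.le
          exact mul_le_mul_of_nonneg_left hstep (by linarith)
      _ ≤ α * (3 * θa) * (1 + σ * (1 - α / 2)) * (4 - α ^ 2) := by
          apply mul_le_mul_of_nonneg_right _ hKα.le
          exact mul_le_mul_of_nonneg_right hθ' hA
      _ = 2 * (α * (3 * θa) / 2 * (1 + σ * (1 - α / 2))) * (4 - α ^ 2) := by ring
  refine le_trans ?_ hR
  -- `10(1−α)σα ≤ (3/2)ασ(2−α/2)(4−α²)` ⟸ `10(1−α) ≤ (3/2)(2−α/2)(4−α²)` times `σα ≥ 0`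
  have hcore : 10 * (1 - α) ≤ 3 / 2 * (2 - α / 2) * (4 - α ^ 2) := by nlinarith [hpoly]
  have := mul_le_mul_of_nonneg_left hcore hσα
  nlinarith [this]

end CostScalarTwo

/-! ### §2 Two particles: the compositions, the holding probabilities, the second step's income -/
section CostTwo
variable {S : Type*} [Fintype S] [DecidableEq S]
variable {W θ : S → ℝ} {acc : S → S → ℝ} {p : ℝ} {K : ℕ} {NC : S → ℕ} {a : S} {PX : Option S → Option S → ℝ}

omit [DecidableEq S] in
/-- **Two ordinary particles:** if `Σ N_C = 2` and `z ≠ v` are both present then `N_C(z) = N_C(v) = 1` and every other content is absent. [ours] -/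
theorem costSide_two_particles [DecidableEq S] (hNC : ∑ u, NC u = 2) {z v : S} (hz : NC z ≠ 0) (hv : NC v ≠ 0) (hvz : v ≠ z) :
    NC z = 1 ∧ NC v = 1 ∧ ∀ u, u ≠ z → u ≠ v → NC u = 0 := by
  have hvz' : v ∈ univ.erase z := mem_erase.mpr ⟨hvz, mem_univ v⟩
  have h1 : ∑ u, NC u = NC z + ∑ u ∈ univ.erase z, NC u := (add_sum_erase univ NC (mem_univ z)).symm
  have h2 : ∑ u ∈ univ.erase z, NC u = NC v + ∑ u ∈ (univ.erase z).erase v, NC u := (add_sum_erase _ NC hvz').symm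
  have hz1 : 1 ≤ NC z := Nat.one_le_iff_ne_zero.mpr hz
  have hv1 : 1 ≤ NC v := Nat.one_le_iff_ne_zero.mpr hv
  have hrest : ∑ u ∈ (univ.erase z).erase v, NC u = 0 := by omega
  refine ⟨by omega, by omega, fun u huz huv => ?_⟩
  have hu : u ∈ (univ.erase z).erase v := mem_erase.mpr ⟨huv, mem_erase.mpr ⟨huz, mem_univ u⟩⟩
  exact (sum_eq_zero_iff.mp hrest) u hu

omit [Fintype S] [DecidableEq S] in
/-- `acc(z,a) ≤ acc(v,a)` when `W_z ≤ W_v`. [ours] -/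
theorem costSide_acc_mono (hW : ∀ v, 0 < W v) (hacc : ∀ h v, acc h v = min 1 (W h / W v)) {z v : S} (hzv : W z ≤ W v) (a : S) :
    acc z a ≤ acc v a := by
  rw [hacc, hacc]; exact min_le_min le_rfl (div_le_div_of_nonneg_right hzv (hW a).le)

/-- **At `K = 2` a present content with a deeper present particle holds with probability `≤ N_C/K`:** `P_X(v,v) ≤ 1/2 = N_C(v)/K` (the swap with `z`, `W_z ≤ W_v`, is always
accepted). [ours] -/
theorem costSide_hold_of_deeper (hW : ∀ v, 0 < W v) (hacc : ∀ h v, acc h v = min 1 (W h / W v))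
    (hPXoff : ∀ h v, h ≠ v → PX (some h) (some v) = if NC h = 0 then 0 else (NC v : ℝ) / K * acc h v)
    (hPXin : ∀ h, PX (some h) none = if NC h = 0 then 0 else acc h a / K)
    (hPXdiag : ∀ h, PX (some h) (some h) = 1 - (∑ v ∈ univ.erase h, PX (some h) (some v) + PX (some h) none))
    (hK : K = 2) {z v : S} (hvz : v ≠ z) (hz1 : NC z = 1) (hv1 : NC v = 1) (hzv : W z ≤ W v) :
    PX (some v) (some v) ≤ (NC v : ℝ) / K := by
  have hv : NC v ≠ 0 := by rw [hv1]; exact one_ne_zero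
  have hz' : z ∈ univ.erase v := mem_erase.mpr ⟨hvz.symm, mem_univ z⟩
  -- the row `v`: the entry at `z` is `1/2`, the others are non-negative
  have hacc1 : acc v z = 1 := by
    rw [hacc]; exact min_eq_left ((one_le_div (hW z)).mpr hzv)
  have hPz : PX (some v) (some z) = 1 / 2 := by
    rw [hPXoff v z hvz, if_neg hv, hz1, hacc1, hK]; norm_num
  have hoff0 : ∀ u ∈ univ.erase v, 0 ≤ PX (some v) (some u) := fun u hu => by
    rw [hPXoff v u (ne_of_mem_erase hu).symm, if_neg hv]
    exact mul_nonneg (div_nonneg (Nat.cast_nonneg _) (Nat.cast_nonneg _)) (starHub_acc_nonneg hW hacc v u)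
  have hsum : PX (some v) (some z) ≤ ∑ u ∈ univ.erase v, PX (some v) (some u) := single_le_sum hoff0 hz'
  have hin0 : 0 ≤ PX (some v) none := by
    rw [hPXin, if_neg hv]; exact div_nonneg (starHub_acc_nonneg hW hacc v a) (Nat.cast_nonneg _)
  rw [hPXdiag, hv1, hK]
  rw [hPz] at hsum
  push_cast
  linarith

omit [DecidableEq S] in
/-- **The second step's income:** if `slack ≥ c` at every present content, `slack(★) ≥ 0` and the tail resolvent `x̃` vanishes at absent contents, then
`E_x̃[slack] ≥ (1−σ)·c·(1 − P_X(z,★))`. [ours] -/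
theorem costSide_secondStep_ge (hP0 : ∀ t t', 0 ≤ PX t t') (hP1 : ∀ t, ∑ t', PX t t' = 1)
    (hPXoff : ∀ h v, h ≠ v → PX (some h) (some v) = if NC h = 0 then 0 else (NC v : ℝ) / K * acc h v)
    {z : S} (hz : NC z ≠ 0) {σ : ℝ} (hσ0 : 0 ≤ σ) {ut sl : Option S → ℝ} (hut : ∀ t, ut t = (1 - σ) * PX (some z) t + σ * ∑ t', ut t' * PX t' t)
    (hut0 : ∀ t, 0 ≤ ut t) (habs : ∀ w, NC w = 0 → ut (some w) = 0) (hsl_none : 0 ≤ sl none) {c : ℝ} (hc : 0 ≤ c)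
    (hsl_some : ∀ v, NC v ≠ 0 → c ≤ sl (some v)) :
    (1 - σ) * (c * (1 - PX (some z) none)) ≤ ∑ t, ut t * sl t := by
  rw [tagged_sum_option]
  -- `x̃ ≥ (1−σ)P_X(z,·)` pointwise
  have hlow : ∀ t, (1 - σ) * PX (some z) t ≤ ut t := fun t => by
    rw [hut t]
    have : 0 ≤ σ * ∑ t', ut t' * PX t' t := mul_nonneg hσ0 (sum_nonneg fun t' _ => mul_nonneg (hut0 t') (hP0 t' t))
    linarith
  -- per present content `ut(v)sl(v) ≥ (1−σ)P_X(z,v)·c`; absent contents contribute `0 = (1−σ)P_X(z,v)c`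
  have hper : ∀ v, (1 - σ) * PX (some z) (some v) * c ≤ ut (some v) * sl (some v) := by
    intro v
    by_cases hv : NC v = 0
    · have hvz : z ≠ v := fun h => hz (h ▸ hv)
      rw [habs v hv, hPXoff z v hvz, if_neg hz, hv]; simp
    · calc (1 - σ) * PX (some z) (some v) * c ≤ ut (some v) * c := mul_le_mul_of_nonneg_right (hlow _) hc
        _ ≤ ut (some v) * sl (some v) := mul_le_mul_of_nonneg_left (hsl_some v hv) (hut0 _)
  have hsum : ∑ v, (1 - σ) * PX (some z) (some v) * c ≤ ∑ v, ut (some v) * sl (some v) := sum_le_sum fun v _ => hper v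
  have hrow : ∑ v, PX (some z) (some v) = 1 - PX (some z) none := by
    have h := hP1 (some z); rw [tagged_sum_option] at h; linarith
  have e : ∑ v, (1 - σ) * PX (some z) (some v) * c = (1 - σ) * (c * (1 - PX (some z) none)) := by
    rw [← hrow, mul_sum, mul_sum]; exact sum_congr rfl fun v _ => by ring
  rw [e] at hsum
  have : 0 ≤ ut none * sl none := mul_nonneg (hut0 none) hsl_none
  linarith

end CostTwo

/-! ### §3 The cost-side inequality at `K = 2`, and for every `K ≥ 2` -/
section CostSideTwo
variable {S : Type*} [Fintype S] [DecidableEq S]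
variable {W θ : S → ℝ} {acc : S → S → ℝ} {p : ℝ} {K : ℕ} {NC : S → ℕ} {a b : S} {PX PY : Option S → Option S → ℝ}

/-- **THE COST-SIDE INEQUALITY, DEEP CONFIGURATION, `K = 2`:** `L·Σ_{n<J}(1−σ)σⁿ(y_{n+1}(z) − x_{n+1}(z))⁺ ≤ 2·s1` (the second step's income included). [ours] -/
theorem tagged_costSide_deep_two (hW : ∀ v, 0 < W v) (hp0 : 0 ≤ p) (hp : ∀ v, p * W v ≤ 1) (hθ : ∀ v, θ v = 1 / (1 + p * W v))
    (hacc : ∀ h v, acc h v = min 1 (W h / W v)) (hK : K = 2) (hNC : ∑ v, NC v = K) (hab : W b ≤ W a)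
    (hnone : ∀ w, NC w ≠ 0 → ¬ (W b < W w ∧ W w < W a))
    (hPXoff : ∀ h v, h ≠ v → PX (some h) (some v) = if NC h = 0 then 0 else (NC v : ℝ) / K * acc h v)
    (hPXin : ∀ h, PX (some h) none = if NC h = 0 then 0 else acc h a / K)
    (hPXdiag : ∀ h, PX (some h) (some h) = 1 - (∑ v ∈ univ.erase h, PX (some h) (some v) + PX (some h) none))
    (hPXout : ∀ v, PX none (some v) = (NC v : ℝ) / K * acc a v) (hPXstay : PX none none = 1 - ∑ v, PX none (some v))
    (hPYoff : ∀ h v, h ≠ v → PY (some h) (some v) = if NC h = 0 then 0 else (NC v : ℝ) / K * acc h v)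
    (hPYin : ∀ h, PY (some h) none = if NC h = 0 then 0 else acc h b / K)
    (hPYdiag : ∀ h, PY (some h) (some h) = 1 - (∑ v ∈ univ.erase h, PY (some h) (some v) + PY (some h) none))
    (hPYout : ∀ v, PY none (some v) = (NC v : ℝ) / K * acc b v) (hPYstay : PY none none = 1 - ∑ v, PY none (some v))
    {z : S} (hz : NC z ≠ 0) (hzb : W z ≤ W b) (hza : W z < W a) (hthree : 2 ≤ NC z ∨ ∃ w, NC w ≠ 0 ∧ W z < W w)
    {x y : ℕ → Option S → ℝ}
    (hx0 : ∀ v, x 0 v = if v = some z then 1 else 0) (hxs : ∀ n v, x (n + 1) v = ∑ h, x n h * PX h v)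
    (hy0 : ∀ v, y 0 v = if v = some z then 1 else 0) (hys : ∀ n v, y (n + 1) v = ∑ h, y n h * PY h v)
    {M : ℝ} (hM : M = ∑ v, θ v * (NC v : ℝ) + θ a) {L : ℝ} (hL : L = 2 * K + M + (∑ v, θ v * (NC v : ℝ) + θ b))
    {σ : ℝ} (hσ0 : 0 ≤ σ) (hσ1 : σ < 1) {ut : Option S → ℝ} (hut : ∀ t, ut t = (1 - σ) * PX (some z) t + σ * ∑ t', ut t' * PX t' t) (J : ℕ) :
    L * ∑ n ∈ range J, (1 - σ) * σ ^ n * max 0 (y (n + 1) (some z) - x (n + 1) (some z))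
      ≤ 2 * ((K + M) * ut none - (∑ v, ut (some v) * (1 - θ v) + ut none * (1 - θ a))) := by
  have hK1 : 1 ≤ K := by omega
  have hK2 : 2 ≤ K := by omega
  have hK0 : (0 : ℝ) < K := by exact_mod_cast (show 0 < K by omega)
  have hKr : (K : ℝ) = 2 := by exact_mod_cast hK
  have hNC2 : ∑ v, NC v = 2 := by rw [hNC, hK]
  have hθm := theta_mem hW hp0 hp hθ
  -- the deficit budget (GEN-41 file 6 (A))
  obtain ⟨hA, -, -, -⟩ := tagged_startClass_deficit hW hacc hK2 hNC hab hnone hPXoff hPXin hPXdiag hPXout hPXstay hPYoff hPYin hPYdiag hPYout hPYstay hz hx0 hxs hy0 hys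
  obtain ⟨-, hD⟩ := hA hzb hza hthree
  have hDJ := hD σ hσ0 hσ1.le J
  -- the certificate slack (GEN-41 file 4)
  obtain ⟨r, hr⟩ : ∃ r : Option S → ℝ, ∀ t, r t = Option.elim t ((K + M) - (1 - θ a)) (fun v => -(1 - θ v)) := ⟨_, fun _ => rfl⟩
  obtain ⟨Λ, hΛ⟩ : ∃ Λ : Option S → ℝ, ∀ t, Λ t = Option.elim t (-(1 - θ a)) (fun _ => 0) := ⟨_, fun _ => rfl⟩
  obtain ⟨sl, hsl⟩ : ∃ sl : Option S → ℝ, ∀ t, sl t = ∑ t', PX t t' * (r t' + Λ t') - Λ t := ⟨_, fun _ => rfl⟩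
  have hrn : r none = (K + M) - (1 - θ a) := by rw [hr]; rfl
  have hrs : ∀ v, r (some v) = -(1 - θ v) := fun v => by rw [hr]; rfl
  have hΛn : Λ none = -(1 - θ a) := by rw [hΛ]; rfl
  have hΛs : ∀ v, Λ (some v) = 0 := fun v => by rw [hΛ]; rfl
  have heq := ledger_tail_eq hsl hut
  have hP0 := tagged_nonneg hW hacc hPXoff hPXin hPXdiag hPXout hPXstay hK1 hNC
  have hP1 := tagged_rowsum (P := PX) hPXdiag hPXstay
  have hut0 : ∀ t, 0 ≤ ut t := geomResolvent_nonneg hP0 hP1 hσ0 hσ1 (ν := fun t => PX (some z) t) (fun t => hP0 _ _) hut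
  have hsl_none : 0 ≤ sl none := by
    rw [hsl]; linarith only [tagged_supersolution_none hW hp0 hp hθ hacc hPXout hPXstay hK1 hNC hM hrn hrs hΛn hΛs]
  have hsl_some : ∀ v, NC v ≠ 0 → 0 ≤ sl (some v) := fun v hv => by
    rw [hsl]; linarith only [tagged_supersolution_some hW hp0 hp hθ hacc hPXoff hPXin hPXdiag hK1 hNC hM hrn hrs hΛn hΛs hv]
  have habs : ∀ w, NC w = 0 → ut (some w) = 0 := fun w hw =>
    tagged_tail_absent hW hacc hPXoff hPXin hPXdiag hPXout hPXstay hK1 hNC hσ0 hσ1 hz hut hw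
  have hΛz : Λ (some z) = 0 := hΛs z
  have hEΛ : ∑ t, ut t * Λ t = -(1 - θ a) * ut none := by rw [tagged_sum_option, hΛn]; simp [hΛs]; ring
  have hEr : ∑ t, ut t * r t = (K + M) * ut none - (∑ v, ut (some v) * (1 - θ v) + ut none * (1 - θ a)) := by
    rw [tagged_sum_option, hrn]; simp only [hrs]
    have e : ∑ v, ut (some v) * -(1 - θ v) = -∑ v, ut (some v) * (1 - θ v) := by rw [← sum_neg_distrib]; exact sum_congr rfl fun v _ => by ring
    rw [e]; ring
  -- `s1 = (1−σ)sl(z) + σE_ũ[sl] + (1−σ)(1−θ_a)ũ(★)` (exact)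
  have hs1eq : (K + M) * ut none - (∑ v, ut (some v) * (1 - θ v) + ut none * (1 - θ a))
      = (1 - σ) * sl (some z) + σ * ∑ t, ut t * sl t + (1 - σ) * ((1 - θ a) * ut none) := by
    rw [← hEr, heq, hΛz, hEΛ]; ring
  have htail0 : 0 ≤ (1 - σ) * ((1 - θ a) * ut none) :=
    mul_nonneg (by linarith only [hσ1]) (mul_nonneg (by linarith only [(hθm a).2]) (hut0 none))
  -- the kernel data at the hub
  set γ := PX (some z) (some z) - PY (some z) (some z) with hγdef
  set q := max 0 ((NC z : ℝ) / K - PX (some z) (some z)) with hqdef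
  have hγeq : γ = (acc z b - acc z a) / K := costSide_gamma_eq hPXoff hPXin hPXdiag hPYoff hPYin hPYdiag hz
  obtain ⟨hγ0, hγle⟩ := costSide_gamma_le hW hacc hab hK1 z
  rw [← hγeq] at hγ0 hγle
  have hq0 : 0 ≤ q := le_max_left _ _
  have hqle : q ≤ acc z a / K := max_le (div_nonneg (starHub_acc_nonneg hW hacc z a) hK0.le) (costSide_q_le hacc hK1 hNC hPXoff hPXin hPXdiag hz)
  have hα0 : 0 ≤ acc z a := starHub_acc_nonneg hW hacc z a
  have hα1 : acc z a ≤ 1 := by rw [hacc]; exact min_le_left _ _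
  -- `L ≤ 4K + 2 = 10`, `L ≥ 0`
  have hMC : ∑ v, θ v * (NC v : ℝ) ≤ K := by
    calc ∑ v, θ v * (NC v : ℝ) ≤ ∑ v, (NC v : ℝ) := sum_le_sum fun v _ =>
            mul_le_of_le_one_left (Nat.cast_nonneg _) (hθm v).2
      _ = K := by exact_mod_cast hNC
  have hMC0 : 0 ≤ ∑ v, θ v * (NC v : ℝ) := sum_nonneg fun v _ => mul_nonneg (by linarith [(hθm v).1]) (Nat.cast_nonneg _)
  have hL0 : 0 ≤ L := by rw [hL, hM]; linarith only [hMC0, (hθm a).1, (hθm b).1, hK0]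
  have hL10 : L ≤ 10 := by rw [hL, hM]; linarith only [hMC, (hθm a).2, (hθm b).2, hKr]
  -- no deficit budget unless the holding probability at the hub is below `N_C(z)/K`
  have hD0 : 0 ≤ ∑ n ∈ range J, (1 - σ) * σ ^ n * max 0 (y (n + 1) (some z) - x (n + 1) (some z)) :=
    sum_nonneg fun n _ => mul_nonneg (mul_nonneg (by linarith) (pow_nonneg hσ0 n)) (le_max_left _ _)
  have hE0 : 0 ≤ ∑ t, ut t * sl t := by
    rw [tagged_sum_option]
    refine add_nonneg (mul_nonneg (hut0 none) hsl_none) (sum_nonneg fun v _ => ?_)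
    by_cases hv : NC v = 0
    · rw [habs v hv, zero_mul]
    · exact mul_nonneg (hut0 _) (hsl_some v hv)
  have hs10 : 0 ≤ (K + M) * ut none - (∑ v, ut (some v) * (1 - θ v) + ut none * (1 - θ a)) := by
    rw [hs1eq]
    have h1 := mul_nonneg (by linarith only [hσ1] : (0:ℝ) ≤ 1 - σ) (hsl_some z hz)
    have h2 := mul_nonneg hσ0 hE0
    linarith only [h1, h2, htail0]
  by_cases hq : q = 0
  · have hle0 : ∑ n ∈ range J, (1 - σ) * σ ^ n * max 0 (y (n + 1) (some z) - x (n + 1) (some z)) ≤ 0 := by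
      refine hDJ.trans ?_
      rw [hq]; simp
    have hD00 : ∑ n ∈ range J, (1 - σ) * σ ^ n * max 0 (y (n + 1) (some z) - x (n + 1) (some z)) = 0 := le_antisymm hle0 hD0
    rw [hD00, mul_zero]; linarith only [hs10]
  -- `q > 0`: the holding probability at `z` is below `N_C(z)/K`
  have hhold : PX (some z) (some z) ≤ (NC z : ℝ) / K := by
    by_contra hcon
    have h' : (NC z : ℝ) / K - PX (some z) (some z) ≤ 0 := by linarith only [not_le.mp hcon]
    exact hq (le_antisymm (max_le le_rfl h') hq0)
  -- the slack is at least `c = acc(z,a)·3θ_a/2` at EVERY present content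
  set c := acc z a * (3 * θ a) / 2 with hcdef
  have hc0 : 0 ≤ c := by rw [hcdef]; have := (hθm a).1; positivity
  have hcK : ∀ v, acc v a * ((K : ℝ) - 2 + 3 * θ a) / K = acc v a * (3 * θ a) / 2 := fun v => by rw [hKr]; ring
  have hslack_all : ∀ v, NC v ≠ 0 → c ≤ sl (some v) := by
    intro v hv
    by_cases hvz : v = z
    · subst hvz
      have h := costSide_slack_ge hW hp0 hp hθ hacc hPXoff hPXin hK1 hM hrn hrs hΛn hΛs hsl hv hhold
      rwa [hcK] at h
    · -- one particle at `z`, one at `v`, `W_z < W_v`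
      obtain ⟨hz1, hv1, hothers⟩ := costSide_two_particles hNC2 hz hv hvz
      have hzv : W z < W v := by
        rcases hthree with h2 | ⟨w, hw, hzw⟩
        · omega
        · have hwz : w ≠ z := fun h => by rw [h] at hzw; exact lt_irrefl _ hzw
          by_cases hwv : w = v
          · rwa [hwv] at hzw
          · exact absurd (hothers w hwz hwv) hw
      have hholdv := costSide_hold_of_deeper hW hacc hPXoff hPXin hPXdiag hK hvz hz1 hv1 hzv.le
      have h := costSide_slack_ge hW hp0 hp hθ hacc hPXoff hPXin hK1 hM hrn hrs hΛn hΛs hsl hv hholdv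
      rw [hcK] at h
      have hmono : acc z a * (3 * θ a) / 2 ≤ acc v a * (3 * θ a) / 2 :=
        div_le_div_of_nonneg_right (mul_le_mul_of_nonneg_right (costSide_acc_mono hW hacc hzv.le a) (by linarith only [(hθm a).1])) (by norm_num)
      exact hmono.trans h
  -- the second step's income
  have hE := costSide_secondStep_ge hP0 hP1 hPXoff hz hσ0 hut hut0 habs hsl_none hc0 hslack_all
  have hPzn : PX (some z) none = acc z a / 2 := by rw [hPXin, if_neg hz, hKr]
  rw [hPzn] at hE
  -- `s1 ≥ (1−σ)·c·(1 + σ(1 − acc(z,a)/2))`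
  have hs1 : (1 - σ) * (c * (1 + σ * (1 - acc z a / 2))) ≤ (K + M) * ut none - (∑ v, ut (some v) * (1 - θ v) + ut none * (1 - θ a)) := by
    rw [hs1eq]
    have h1 : (1 - σ) * c ≤ (1 - σ) * sl (some z) := mul_le_mul_of_nonneg_left (hslack_all z hz) (by linarith only [hσ1])
    have h2 : σ * ((1 - σ) * (c * (1 - acc z a / 2))) ≤ σ * ∑ t, ut t * sl t := mul_le_mul_of_nonneg_left hE hσ0
    have e : (1 - σ) * (c * (1 + σ * (1 - acc z a / 2))) = (1 - σ) * c + σ * ((1 - σ) * (c * (1 - acc z a / 2))) := by ring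
    rw [e]; linarith only [h1, h2, htail0]
  -- the scalar inequality
  have hq2 : q ≤ acc z a / 2 := by rwa [hKr] at hqle
  have hγ2 : γ ≤ (1 - acc z a) / 2 := by rwa [hKr] at hγle
  have hscal := costSide_scalar_two hL10 hα0 hα1 (hθm a).1 hγ0 hγ2 hq0 hq2 hσ0 hσ1.le
  -- chain
  calc L * ∑ n ∈ range J, (1 - σ) * σ ^ n * max 0 (y (n + 1) (some z) - x (n + 1) (some z))
      ≤ L * ((1 - σ) * (γ * (σ * q / (1 - (σ * q) ^ 2)))) := mul_le_mul_of_nonneg_left hDJ hL0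
    _ = (1 - σ) * (L * (γ * (σ * q / (1 - (σ * q) ^ 2)))) := by ring
    _ ≤ (1 - σ) * (2 * (c * (1 + σ * (1 - acc z a / 2)))) := by
        apply mul_le_mul_of_nonneg_left _ (by linarith only [hσ1])
        rw [hcdef]; exact hscal
    _ = 2 * ((1 - σ) * (c * (1 + σ * (1 - acc z a / 2)))) := by ring
    _ ≤ 2 * ((K + M) * ut none - (∑ v, ut (some v) * (1 - θ v) + ut none * (1 - θ a))) := mul_le_mul_of_nonneg_left hs1 (by norm_num)

/-- **THE COST-SIDE INEQUALITY, DEEP CONFIGURATION, EVERY `K ≥ 2`** (`K = 2`: the theorem above; `K ≥ 3`: GEN-41 file 7). [ours] -/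
theorem tagged_costSide_deep_all (hW : ∀ v, 0 < W v) (hp0 : 0 ≤ p) (hp : ∀ v, p * W v ≤ 1) (hθ : ∀ v, θ v = 1 / (1 + p * W v))
    (hacc : ∀ h v, acc h v = min 1 (W h / W v)) (hK : 2 ≤ K) (hNC : ∑ v, NC v = K) (hab : W b ≤ W a)
    (hnone : ∀ w, NC w ≠ 0 → ¬ (W b < W w ∧ W w < W a))
    (hPXoff : ∀ h v, h ≠ v → PX (some h) (some v) = if NC h = 0 then 0 else (NC v : ℝ) / K * acc h v)
    (hPXin : ∀ h, PX (some h) none = if NC h = 0 then 0 else acc h a / K)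
    (hPXdiag : ∀ h, PX (some h) (some h) = 1 - (∑ v ∈ univ.erase h, PX (some h) (some v) + PX (some h) none))
    (hPXout : ∀ v, PX none (some v) = (NC v : ℝ) / K * acc a v) (hPXstay : PX none none = 1 - ∑ v, PX none (some v))
    (hPYoff : ∀ h v, h ≠ v → PY (some h) (some v) = if NC h = 0 then 0 else (NC v : ℝ) / K * acc h v)
    (hPYin : ∀ h, PY (some h) none = if NC h = 0 then 0 else acc h b / K)
    (hPYdiag : ∀ h, PY (some h) (some h) = 1 - (∑ v ∈ univ.erase h, PY (some h) (some v) + PY (some h) none))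
    (hPYout : ∀ v, PY none (some v) = (NC v : ℝ) / K * acc b v) (hPYstay : PY none none = 1 - ∑ v, PY none (some v))
    {z : S} (hz : NC z ≠ 0) (hzb : W z ≤ W b) (hza : W z < W a) (hthree : 2 ≤ NC z ∨ ∃ w, NC w ≠ 0 ∧ W z < W w)
    {x y : ℕ → Option S → ℝ}
    (hx0 : ∀ v, x 0 v = if v = some z then 1 else 0) (hxs : ∀ n v, x (n + 1) v = ∑ h, x n h * PX h v)
    (hy0 : ∀ v, y 0 v = if v = some z then 1 else 0) (hys : ∀ n v, y (n + 1) v = ∑ h, y n h * PY h v)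
    {M : ℝ} (hM : M = ∑ v, θ v * (NC v : ℝ) + θ a) {L : ℝ} (hL : L = 2 * K + M + (∑ v, θ v * (NC v : ℝ) + θ b))
    {σ : ℝ} (hσ0 : 0 ≤ σ) (hσ1 : σ < 1) {ut : Option S → ℝ} (hut : ∀ t, ut t = (1 - σ) * PX (some z) t + σ * ∑ t', ut t' * PX t' t) (J : ℕ) :
    L * ∑ n ∈ range J, (1 - σ) * σ ^ n * max 0 (y (n + 1) (some z) - x (n + 1) (some z))
      ≤ 2 * ((K + M) * ut none - (∑ v, ut (some v) * (1 - θ v) + ut none * (1 - θ a))) := by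
  rcases Nat.eq_or_lt_of_le hK with h2 | h3
  · exact tagged_costSide_deep_two hW hp0 hp hθ hacc h2.symm hNC hab hnone hPXoff hPXin hPXdiag hPXout hPXstay hPYoff hPYin hPYdiag hPYout hPYstay
      hz hzb hza hthree hx0 hxs hy0 hys hM hL hσ0 hσ1 hut J
  · exact tagged_costSide_deep hW hp0 hp hθ hacc (by omega) hNC hab hnone hPXoff hPXin hPXdiag hPXout hPXstay hPYoff hPYin hPYdiag hPYout hPYstay
      hz hzb hza hthree hx0 hxs hy0 hys hM hL hσ0 hσ1 hut J

end CostSideTwo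

end Summit.Ventures.LatticeQCDFlow.Scaling
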